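import Literature.Geometry.Riemannian.ShrinkingSphereMCF
import Literature.Geometry.Riemannian.LevelSetFlowExtinction
import Literature.Geometry.Riemannian.EuclideanHypersurfaceContact
import Literature.Analysis.Calculus.HamiltonMinimumTrick
import HarnessLib

/-!
# The comparison (avoidance) principle for classical mean curvature flows in `ℝⁿ⁺¹`;
# classical flows are weak set flows

Topic `Literature/Geometry/Riemannian`. For two classical mean curvature flows
`F₁ : [a, b] × N₁ → ℝⁿ⁺¹`, `F₂ : [a, b] × N₂ → ℝⁿ⁺¹` of closed hypersurfaces
(`Literature.Geometry.Riemannian.IsClassicalMCF`, `MeanConvexLevelSetFlow.lean`, for the Euclidean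
metric `euclideanMetric`), **the distance between `F₁(t, N₁)` and `F₂(t, N₂)` is non-decreasing**
(C. Mantegazza, *Lecture Notes on Mean Curvature Flow* (2011), Thm. 2.2.1), hence **disjoint flows
stay disjoint** — the avoidance principle (M. Ritoré–C. Sinestrari 2010, Thm. 4.2; B. White 2000,
§2). Consequently the family `t ↦ F(t, N)` of a classical flow is a WEAK SET FLOW in the sense of
Hershkovits–White (`IsWeakSetFlowIn`, whose defining property is avoidance of classical flows —
so far inhabited in the tree only by the empty and the instantly vanishing flows), and lies inside
the LEVEL SET FLOW of its initial hypersurface (`levelSetFlow`, the biggest weak set flow); e.g. the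
level set flow of a round sphere contains the shrinking spheres and is nonempty exactly until
Huisken's extinction time `r₀²/(2n)`. Everything is PROVED; no definitions, no named facts.

## Contents

* `contDiffAt_slice`, `hasDerivAt_slice`, `mfderiv_slice_apply_one`, `continuousOn_timeDeriv` —
  calculus of a family `F : ℝ → N → W` jointly `C^∞` on `U × N` (the regularity clause of
  `IsClassicalMCF`): slices are smooth curves, the time derivative of `IsClassicalMCF.velocity_eq`
  is `deriv (F · y) t`, and `(t, y) ↦ ∂ₜF(t, y)` is jointly continuous (chart representation).
* `IsClassicalMCF.timeDeriv_norm_sq_nonneg` — at a pair `(p, q)` minimising `‖F₁(t, ·) - F₂(t, ·)‖`,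
  `∂ₜ‖F₁(t, p) - F₂(t, q)‖² = 2⟪F₁ p - F₂ q, -H₁ν₁ + H₂ν₂⟫ ≥ 0` (flow equation `∂ₜF = -Hν` and
  `EuclideanHypersurface.inner_meanCurvature_smul_sub_nonneg` of
  `EuclideanHypersurfaceContact.lean`).
* `IsClassicalMCF.le_norm_sub` — **comparison principle**: lower bounds of `‖F₁(a, ·) - F₂(a, ·)‖`
  persist on `[a, b]` (Hamilton's trick `Literature.Analysis.Calculus.forall_le_of_forall_le` on
  the compact `N₁ × N₂`); `IsClassicalMCF.monotoneOn_iInf_norm_sub` — the distance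
  `inf ‖F₁(t, ·) - F₂(t, ·)‖` is non-decreasing.
* `IsClassicalMCF.disjoint_range` — **avoidance principle**.
* `IsClassicalMCF.isClosed_track`, `IsClassicalMCF.isWeakSetFlowIn` — **classical flows are weak
  set flows** on every time set `I ⊆ [a, ∞)`; `IsClassicalMCF.range_subset_levelSetFlow` —
  `F(t, N) ⊆ F_t(K₀)` for `K₀ ⊇ F(0, N)`, `t ∈ [0, b]`.
* `sphere_subset_levelSetFlow_sphere`, `levelSetFlow_sphere_nonempty_iff` — the round sphere:
  `∂B(c, √(r₀² - 2nt)) ⊆ F_t(∂B(c, r₀))` for `0 ≤ t < r₀²/(2n)`, and `F_t(∂B(c, r₀)) ≠ ∅` iff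
  `2nt < r₀²` (with `levelSetFlow_eq_empty_of_lt` of `LevelSetFlowExtinction.lean`).

## References

* C. Mantegazza, *Lecture Notes on Mean Curvature Flow*, Progress in Mathematics 290,
  Birkhäuser 2011, Lemma 2.1.3 (Hamilton's trick) and Thm. 2.2.1. [Mantegazza2011]
* M. Ritoré, C. Sinestrari, *Mean Curvature Flow and Isoperimetric Inequalities*, Adv. Courses
  in Math. CRM Barcelona, Birkhäuser 2010, Part II (Sinestrari), Thm. 4.2. [RitoreSinestrari2010]
* R. S. Hamilton, *Four-manifolds with positive curvature operator*, J. Differential Geom. 24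
  (1986), Lemma 3.5. [Hamilton1986]
* B. White, *The size of the singular set in mean curvature flow of mean-convex sets*, J. Amer.
  Math. Soc. 13 (2000), §2. [White2000]
* O. Hershkovits, B. White, *Nonfattening of mean curvature flow at singularities of mean convex
  type*, Comm. Pure Appl. Math. 73 (2020), Appendix, Def. 19. [HershkovitsWhite2019]
* G. Huisken, *Flow by mean curvature of convex surfaces into spheres*, J. Differential Geom. 20
  (1984), §1. [Huisken1984]
-/

noncomputable section

open Bundle Set Function Metric Module Filter
open scoped Manifold ContDiff Topology RealInnerProductSpace

namespace Literature.Geometry.Riemannian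

open Lorentzian Lorentzian.PseudoRiemannianMetric Literature.Analysis.Calculus EuclideanHypersurface

/-! ### Smooth one-parameter families of maps into a vector space: the time derivative -/

section Family

variable {E' : Type*} [NormedAddCommGroup E'] [NormedSpace ℝ E'] {H' : Type*} [TopologicalSpace H']
  {I' : ModelWithCorners ℝ E' H'} {N : Type*} [TopologicalSpace N]
  [ChartedSpace H' N] {W : Type*} [NormedAddCommGroup W] [NormedSpace ℝ W]

/-- Each time slice `s ↦ F s y` of a family jointly `C^∞` on `U × N` (`U` open) is a `C^∞`
curve of `W` at every `t ∈ U`. [folklore] -/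
theorem contDiffAt_slice {F : ℝ → N → W} {U : Set ℝ} (hU : IsOpen U)
    (hF : ContMDiffOn (𝓘(ℝ, ℝ).prod I') 𝓘(ℝ, W) ∞ (fun p : ℝ × N ↦ F p.1 p.2) (U ×ˢ univ))
    {t : ℝ} (ht : t ∈ U) (y : N) : ContDiffAt ℝ ∞ (fun s ↦ F s y) t := by
  have h1 : ContMDiffAt (𝓘(ℝ, ℝ).prod I') 𝓘(ℝ, W) ∞ (fun p : ℝ × N ↦ F p.1 p.2) (t, y) :=
    hF.contMDiffAt ((hU.prod isOpen_univ).mem_nhds ⟨ht, mem_univ y⟩)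
  have h2 : ContMDiffAt 𝓘(ℝ, ℝ) (𝓘(ℝ, ℝ).prod I') ∞ (fun s : ℝ ↦ (s, y)) t :=
    contMDiffAt_id.prodMk contMDiffAt_const
  exact (h1.comp t h2).contDiffAt

/-- The slice `s ↦ F s y` is differentiable at `t ∈ U`, with derivative `deriv (F · y) t`.
[folklore] -/
theorem hasDerivAt_slice {F : ℝ → N → W} {U : Set ℝ} (hU : IsOpen U)
    (hF : ContMDiffOn (𝓘(ℝ, ℝ).prod I') 𝓘(ℝ, W) ∞ (fun p : ℝ × N ↦ F p.1 p.2) (U ×ˢ univ))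
    {t : ℝ} (ht : t ∈ U) (y : N) :
    HasDerivAt (fun s ↦ F s y) (deriv (fun s ↦ F s y) t) t :=
  ((contDiffAt_slice hU hF ht y).differentiableAt (by simp)).hasDerivAt

omit [TopologicalSpace N] in
/-- **The time derivative** `∂ₜF(t, y) = d(F(·, y))_t (1)` in the form used by
`IsClassicalMCF.velocity_eq` (Mathlib's `mfderiv … t 1`) is the ordinary derivative
`deriv (F · y) t` of the slice. [folklore] -/
theorem mfderiv_slice_apply_one {F : ℝ → N → W} (t : ℝ) (y : N) :
    mfderiv 𝓘(ℝ, ℝ) 𝓘(ℝ, W) (fun s ↦ F s y) t 1 = deriv (fun s ↦ F s y) t := by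
  have h2 : mfderiv 𝓘(ℝ, ℝ) 𝓘(ℝ, W) (fun s ↦ F s y) t = fderiv ℝ (fun s ↦ F s y) t :=
    mfderiv_eq_fderiv
  rw [h2]
  rfl

variable [I'.Boundaryless] [IsManifold I' ∞ N]

/-- **Joint continuity of the time derivative** of a family jointly `C^∞` on `U × N`: in a chart
`e` of `N` at `y₀`, `∂ₜF(s, y) = Dh(s, e y)(1, 0)` for the chart representation
`h(s, u) = F(s, e⁻¹ u)`, which is `C^∞` on the open set `U × e.target`, so `Dh` is continuous.
[folklore] -/
theorem continuousOn_timeDeriv {F : ℝ → N → W} {U : Set ℝ} (hU : IsOpen U)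
    (hF : ContMDiffOn (𝓘(ℝ, ℝ).prod I') 𝓘(ℝ, W) ∞ (fun p : ℝ × N ↦ F p.1 p.2) (U ×ˢ univ)) :
    ContinuousOn (fun p : ℝ × N ↦ deriv (fun s ↦ F s p.2) p.1) (U ×ˢ univ) := by
  rintro ⟨t₀, y₀⟩ ⟨ht₀, -⟩
  set ψ := extChartAt 𝓘(ℝ, ℝ) t₀ with hψ
  set e := extChartAt I' y₀ with he
  set h : ℝ × E' → W := fun z ↦ F (ψ.symm z.1) (e.symm z.2) with hh_def
  set S : Set (ℝ × E') := (ψ.target ∩ ψ.symm ⁻¹' U) ×ˢ e.target with hS_def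
  -- `h` is `C^∞` on the open set `S`
  have hS : IsOpen S :=
    (((continuousOn_extChartAt_symm t₀).isOpen_inter_preimage (isOpen_extChartAt_target t₀)
      hU)).prod (isOpen_extChartAt_target y₀)
  have hs : (ψ.source ∩ U) ×ˢ e.source ⊆ (extChartAt (𝓘(ℝ, ℝ).prod I') (t₀, y₀)).source := by
    rw [extChartAt_prod, PartialEquiv.prod_source]
    exact prod_mono inter_subset_left subset_rfl
  have h2s : MapsTo (fun p : ℝ × N ↦ F p.1 p.2) ((ψ.source ∩ U) ×ˢ e.source)
      (extChartAt 𝓘(ℝ, W) (F t₀ y₀)).source := by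
    simp [MapsTo]
  have hcd := (contMDiffOn_iff_of_subset_source' hs h2s).1
    (hF.mono (prod_mono inter_subset_right (subset_univ _)))
  have hhS : ContDiffOn ℝ ∞ h S := by
    have hSeq : S = (ψ.prod e) '' ((ψ.source ∩ U) ×ˢ e.source) := by
      rw [PartialEquiv.prod_coe, ← prod_image_image_eq, hS_def,
        ← PartialEquiv.image_source_inter_eq', PartialEquiv.image_source_eq_target]
    rw [extChartAt_prod, extChartAt_model_space_eq_id] at hcd
    dsimp only at hcd
    rw [← hψ, ← he] at hcd
    rw [hSeq]
    refine hcd.congr fun z _ ↦ ?_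
    simp only [hh_def, Function.comp_apply, PartialEquiv.refl_coe, id_eq, PartialEquiv.prod_symm,
      PartialEquiv.prod_coe]
  have hDh : ContinuousOn (fderiv ℝ h) S := hhS.continuousOn_fderiv_of_isOpen hS (by simp)
  -- `ψ` is the identity
  have hψid : ∀ s, ψ s = s := fun s ↦ by simp [hψ]
  have hψsymm : ∀ s, ψ.symm s = s := fun s ↦ by simp [hψ]
  have hψsrc : ∀ s, s ∈ ψ.source := fun s ↦ by simp [hψ]
  -- the time derivative equals `Dh(s, e y)(1, 0)` on the neighbourhood `U × e.source` of `(t₀, y₀)`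
  have hmemS : ∀ {s : ℝ} {y : N}, s ∈ U → y ∈ e.source → (ψ s, e y) ∈ S := fun {s y} hs hy ↦ by
    refine ⟨⟨ψ.map_source (hψsrc s), ?_⟩, e.map_source hy⟩
    show ψ.symm (ψ s) ∈ U
    rwa [ψ.left_inv (hψsrc s)]
  have hformula : ∀ {s : ℝ} {y : N}, s ∈ U → y ∈ e.source →
      deriv (fun s' ↦ F s' y) s = fderiv ℝ h (ψ s, e y) ((1 : ℝ), (0 : E')) := by
    intro s y hs hy
    have hd : HasFDerivAt h (fderiv ℝ h (ψ s, e y)) (ψ s, e y) :=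
      ((hhS.differentiableOn (by simp)).differentiableAt (hS.mem_nhds (hmemS hs hy))).hasFDerivAt
    have hsl : HasFDerivAt (fun s' : ℝ ↦ h (s', e y))
        ((fderiv ℝ h (ψ s, e y)).comp (ContinuousLinearMap.inl ℝ ℝ E')) s := by
      have := hd.comp s (hasFDerivAt_prodMk_left (𝕜 := ℝ) (ψ s) (e y))
      rwa [hψid s] at this
    have hfun : (fun s' : ℝ ↦ h (s', e y)) = fun s' ↦ F s' y := by
      funext s'
      simp only [hh_def, hψsymm, e.left_inv hy]
    rw [hfun] at hsl
    rw [hsl.hasDerivAt.deriv]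
    rfl
  -- continuity of `(s, y) ↦ Dh(s, e y)(1, 0)` at `(t₀, y₀)`
  have hG : ContinuousAt (fun p : ℝ × N ↦ fderiv ℝ h (ψ p.1, e p.2) ((1 : ℝ), (0 : E'))) (t₀, y₀) := by
    have h1 : ContinuousAt (fun p : ℝ × N ↦ (ψ p.1, e p.2)) (t₀, y₀) := by
      refine ContinuousAt.prodMk ?_ ?_
      · have : (fun p : ℝ × N ↦ ψ p.1) = fun p ↦ p.1 := funext fun p ↦ hψid p.1
        rw [this]; exact continuousAt_fst
      · exact (continuousAt_extChartAt (I := I') y₀).comp_of_eq continuousAt_snd rfl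
    have h2 : ContinuousAt (fderiv ℝ h) (ψ t₀, e y₀) :=
      hDh.continuousAt (hS.mem_nhds (hmemS ht₀ (mem_extChartAt_source y₀)))
    exact (h2.comp_of_eq h1 rfl).clm_apply continuousAt_const
  have heq : (fun p : ℝ × N ↦ deriv (fun s ↦ F s p.2) p.1)
      =ᶠ[𝓝 (t₀, y₀)] fun p ↦ fderiv ℝ h (ψ p.1, e p.2) ((1 : ℝ), (0 : E')) := by
    filter_upwards [(hU.prod (isOpen_extChartAt_source (I := I') y₀)).mem_nhds
      ⟨ht₀, mem_extChartAt_source (I := I') y₀⟩] with p hp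
    exact hformula hp.1 hp.2
  exact (hG.congr heq.symm).continuousWithinAt

end Family

/-! ### The comparison principle for classical mean curvature flows in `ℝⁿ⁺¹` -/

section Comparison

variable {n : ℕ}
  {N₁ : Type*} [TopologicalSpace N₁] [ChartedSpace (EuclideanSpace ℝ (Fin n)) N₁]
  [IsManifold (𝓡 n) ∞ N₁]
  {N₂ : Type*} [TopologicalSpace N₂] [ChartedSpace (EuclideanSpace ℝ (Fin n)) N₂]
  [IsManifold (𝓡 n) ∞ N₂]
  {F₁ : ℝ → N₁ → EuclideanSpace ℝ (Fin (n + 1))}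
  {ν₁ : (t : ℝ) → NormalField (𝓡 (n + 1)) (F₁ t)}
  {F₂ : ℝ → N₂ → EuclideanSpace ℝ (Fin (n + 1))}
  {ν₂ : (t : ℝ) → NormalField (𝓡 (n + 1)) (F₂ t)} {a b : ℝ}

/-- **`∂ₜ ‖F₁(t, p) - F₂(t, q)‖² ≥ 0` at a distance-minimising pair** of two classical mean
curvature flows in `ℝⁿ⁺¹`: by the flow equation `∂ₜFᵢ = -Hᵢ νᵢ` (`IsClassicalMCF.velocity_eq`)
the derivative is `2⟪F₁ p - F₂ q, -H₁ν₁ + H₂ν₂⟫`, nonnegative by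
`EuclideanHypersurface.inner_meanCurvature_smul_sub_nonneg`. Mantegazza 2011, proof of
Thm. 2.2.1. [cite: Mantegazza2011, Thm. 2.2.1 (proof)] -/
theorem IsClassicalMCF.timeDeriv_norm_sq_nonneg
    (h₁ : IsClassicalMCF (euclideanMetric (EuclideanSpace ℝ (Fin (n + 1)))) F₁ ν₁ a b)
    (h₂ : IsClassicalMCF (euclideanMetric (EuclideanSpace ℝ (Fin (n + 1)))) F₂ ν₂ a b)
    {t : ℝ} (ht : t ∈ Icc a b) {p : N₁} {q : N₂}
    (hmin : ∀ p' q', ‖F₁ t p - F₂ t q‖ ≤ ‖F₁ t p' - F₂ t q'‖) :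
    0 ≤ 2 * ⟪F₁ t p - F₂ t q, deriv (fun s ↦ F₁ s p) t - deriv (fun s ↦ F₂ s q) t⟫ := by
  -- the normals and mean curvatures, read in the ambient vector space
  set w₁ : EuclideanSpace ℝ (Fin (n + 1)) := ν₁ t p with hw₁
  set w₂ : EuclideanSpace ℝ (Fin (n + 1)) := ν₂ t q with hw₂
  set H₁ : ℝ := (euclideanMetric _).meanCurvature (F₁ t) contMDiff_pullbackBilin_holds
    (h₁.isSpacelikeImmersion t ht) (ν₁ t) p with hH₁
  set H₂ : ℝ := (euclideanMetric _).meanCurvature (F₂ t) contMDiff_pullbackBilin_holds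
    (h₂.isSpacelikeImmersion t ht) (ν₂ t) q with hH₂
  have hv₁ : deriv (fun s ↦ F₁ s p) t = (-H₁) • w₁ := by
    rw [← mfderiv_slice_apply_one]
    exact h₁.velocity_eq t ht p
  have hv₂ : deriv (fun s ↦ F₂ s q) t = (-H₂) • w₂ := by
    rw [← mfderiv_slice_apply_one]
    exact h₂.velocity_eq t ht q
  rw [hv₁, hv₂, neg_smul, neg_smul, sub_neg_eq_add, neg_add_eq_sub]
  have hdim : finrank ℝ (EuclideanSpace ℝ (Fin n)) + 1 =
      finrank ℝ (EuclideanSpace ℝ (Fin (n + 1))) := by simp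
  have key := inner_meanCurvature_smul_sub_nonneg (I' := 𝓡 n)
    (contMDiff_pullbackBilin_holds) (contMDiff_pullbackBilin_holds)
    (h₁.isSpacelikeImmersion t ht) (h₂.isSpacelikeImmersion t ht)
    (h₁.isUnitNormal t ht) (contMDiff_of_contMDiff_lift (h₁.contMDiff_normal t ht)).2
    (h₂.isUnitNormal t ht) (contMDiff_of_contMDiff_lift (h₂.contMDiff_normal t ht)).2
    hdim hmin
  rw [real_inner_comm] at key
  positivity

/-- **The comparison principle (Mantegazza 2011, Thm. 2.2.1): the distance between two compact
mean curvature flows of `ℝⁿ⁺¹` is non-decreasing.** For two classical mean curvature flows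
`F₁ : [a, b] × N₁ → ℝⁿ⁺¹`, `F₂ : [a, b] × N₂ → ℝⁿ⁺¹` of closed hypersurfaces (`IsClassicalMCF` for
the Euclidean metric), every lower bound of `‖F₁(a, ·) - F₂(a, ·)‖` is a lower bound of
`‖F₁(t, ·) - F₂(t, ·)‖` for all `t ∈ [a, b]`. Proof: Hamilton's trick
(`Literature.Analysis.Calculus.forall_le_of_forall_le`) for
`φ(t, (p, q)) = ‖F₁(t, p) - F₂(t, q)‖²` on the compact `N₁ × N₂`, whose time derivative is
nonnegative at minimisers (`timeDeriv_norm_sq_nonneg`); joint continuity of `φ` and `∂ₜφ` from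
the joint smoothness of the flows (`continuousOn_timeDeriv`).
[cite: Mantegazza2011, Thm. 2.2.1] [cite: Hamilton1986, Lemma 3.5] -/
theorem IsClassicalMCF.le_norm_sub
    (h₁ : IsClassicalMCF (euclideanMetric (EuclideanSpace ℝ (Fin (n + 1)))) F₁ ν₁ a b)
    (h₂ : IsClassicalMCF (euclideanMetric (EuclideanSpace ℝ (Fin (n + 1)))) F₂ ν₂ a b)
    {δ : ℝ} (hδ : ∀ p q, δ ≤ ‖F₁ a p - F₂ a q‖) {t : ℝ} (ht : t ∈ Icc a b) (p : N₁) (q : N₂) :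
    δ ≤ ‖F₁ t p - F₂ t q‖ := by
  rcases le_or_gt δ 0 with hδ0 | hδ0
  · exact hδ0.trans (norm_nonneg _)
  haveI := h₁.compactSpace
  haveI := h₂.compactSpace
  obtain ⟨U₁, hU₁, hI₁, hF₁⟩ := h₁.contMDiffOn
  obtain ⟨U₂, hU₂, hI₂, hF₂⟩ := h₂.contMDiffOn
  -- the data of Hamilton's trick on `K = N₁ × N₂`, `U = U₁ ∩ U₂`
  set φ : ℝ → N₁ × N₂ → ℝ := fun s k ↦ ‖F₁ s k.1 - F₂ s k.2‖ ^ 2 with hφ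
  set φ' : ℝ → N₁ × N₂ → ℝ := fun s k ↦ 2 * ⟪F₁ s k.1 - F₂ s k.2,
    deriv (fun r ↦ F₁ r k.1) s - deriv (fun r ↦ F₂ r k.2) s⟫ with hφ'
  have hU : IsOpen (U₁ ∩ U₂) := hU₁.inter hU₂
  have hab : Icc a b ⊆ U₁ ∩ U₂ := subset_inter hI₁ hI₂
  have hc₁ : ContinuousOn (fun p : ℝ × (N₁ × N₂) ↦ F₁ p.1 p.2.1) ((U₁ ∩ U₂) ×ˢ univ) :=
    hF₁.continuousOn.comp (f := fun p : ℝ × (N₁ × N₂) ↦ (p.1, p.2.1)) (by fun_prop)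
      fun p hp ↦ ⟨hp.1.1, mem_univ _⟩
  have hc₂ : ContinuousOn (fun p : ℝ × (N₁ × N₂) ↦ F₂ p.1 p.2.2) ((U₁ ∩ U₂) ×ˢ univ) :=
    hF₂.continuousOn.comp (f := fun p : ℝ × (N₁ × N₂) ↦ (p.1, p.2.2)) (by fun_prop)
      fun p hp ↦ ⟨hp.1.2, mem_univ _⟩
  have hcont : ContinuousOn (uncurry φ) ((U₁ ∩ U₂) ×ˢ univ) := by
    have : uncurry φ = fun p : ℝ × (N₁ × N₂) ↦ ‖F₁ p.1 p.2.1 - F₂ p.1 p.2.2‖ ^ 2 := by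
      funext p; rfl
    rw [this]
    exact ((hc₁.sub hc₂).norm).pow 2
  have hderiv : ∀ s ∈ U₁ ∩ U₂, ∀ k, HasDerivAt (fun r ↦ φ r k) (φ' s k) s := by
    intro s hs k
    have h := ((hasDerivAt_slice hU₁ hF₁ hs.1 k.1).sub (hasDerivAt_slice hU₂ hF₂ hs.2 k.2)).norm_sq
    exact h
  have hd₁ : ContinuousOn (fun p : ℝ × (N₁ × N₂) ↦ deriv (fun r ↦ F₁ r p.2.1) p.1)
      ((U₁ ∩ U₂) ×ˢ univ) :=
    (continuousOn_timeDeriv hU₁ hF₁).comp (f := fun p : ℝ × (N₁ × N₂) ↦ (p.1, p.2.1))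
      (by fun_prop) fun p hp ↦ ⟨hp.1.1, mem_univ _⟩
  have hd₂ : ContinuousOn (fun p : ℝ × (N₁ × N₂) ↦ deriv (fun r ↦ F₂ r p.2.2) p.1)
      ((U₁ ∩ U₂) ×ˢ univ) :=
    (continuousOn_timeDeriv hU₂ hF₂).comp (f := fun p : ℝ × (N₁ × N₂) ↦ (p.1, p.2.2))
      (by fun_prop) fun p hp ↦ ⟨hp.1.2, mem_univ _⟩
  have hcont' : ContinuousOn (uncurry φ') ((U₁ ∩ U₂) ×ˢ univ) := by
    have : uncurry φ' = fun p : ℝ × (N₁ × N₂) ↦ 2 * ⟪F₁ p.1 p.2.1 - F₂ p.1 p.2.2,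
        deriv (fun r ↦ F₁ r p.2.1) p.1 - deriv (fun r ↦ F₂ r p.2.2) p.1⟫ := by
      funext p; rfl
    rw [this]
    exact continuousOn_const.mul ((hc₁.sub hc₂).inner (hd₁.sub hd₂))
  have hsign : ∀ s ∈ Ico a b, ∀ k, IsMinOn (φ s) univ k → 0 ≤ φ' s k := by
    intro s hs k hk
    have hmin : ∀ p' q', ‖F₁ s k.1 - F₂ s k.2‖ ≤ ‖F₁ s p' - F₂ s q'‖ := fun p' q' ↦ by
      have h := hk (mem_univ (p', q'))
      simp only [hφ] at h
      exact (pow_le_pow_iff_left₀ (norm_nonneg _) (norm_nonneg _) two_ne_zero).1 h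
    exact h₁.timeDeriv_norm_sq_nonneg h₂ (Ico_subset_Icc_self hs) hmin
  have hc : ∀ k : N₁ × N₂, δ ^ 2 ≤ φ a k := fun k ↦
    pow_le_pow_left₀ hδ0.le (hδ k.1 k.2) 2
  have key := forall_le_of_forall_le hU hcont hderiv hcont' hab hsign hc ht (p, q)
  simp only [hφ] at key
  exact (pow_le_pow_iff_left₀ hδ0.le (norm_nonneg _) two_ne_zero).1 key

/-- The same in `⨅` form: **`t ↦ inf_{p, q} ‖F₁(t, p) - F₂(t, q)‖` is non-decreasing on `[a, b]`**
(the distance between the two evolving hypersurfaces). [cite: Mantegazza2011, Thm. 2.2.1] -/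
theorem IsClassicalMCF.monotoneOn_iInf_norm_sub
    (h₁ : IsClassicalMCF (euclideanMetric (EuclideanSpace ℝ (Fin (n + 1)))) F₁ ν₁ a b)
    (h₂ : IsClassicalMCF (euclideanMetric (EuclideanSpace ℝ (Fin (n + 1)))) F₂ ν₂ a b) :
    MonotoneOn (fun t ↦ ⨅ k : N₁ × N₂, ‖F₁ t k.1 - F₂ t k.2‖) (Icc a b) := by
  intro s hs t ht hst
  dsimp only
  by_cases hne : Nonempty (N₁ × N₂)
  swap
  · haveI : IsEmpty (N₁ × N₂) := not_nonempty_iff.1 hne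
    rw [Real.iInf_of_isEmpty, Real.iInf_of_isEmpty]
  haveI := hne
  refine le_ciInf fun k ↦ ?_
  have hsb : Icc s b ⊆ Icc a b := Icc_subset_Icc hs.1 le_rfl
  refine (h₁.mono hsb).le_norm_sub (h₂.mono hsb) (fun p q ↦ ?_) ⟨hst, ht.2⟩ k.1 k.2
  exact ciInf_le ⟨0, by rintro _ ⟨k', rfl⟩; exact norm_nonneg _⟩ (p, q)

/-- **The avoidance principle (Ritoré–Sinestrari 2010, Thm. 4.2; Mantegazza 2011, Cor. of
Thm. 2.2.1): disjoint compact mean curvature flows of `ℝⁿ⁺¹` stay disjoint.** If the initial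
hypersurfaces `F₁(a, N₁)`, `F₂(a, N₂)` are disjoint, so are `F₁(t, N₁)`, `F₂(t, N₂)` for all
`t ∈ [a, b]` (the initial distance is positive by compactness and persists by `le_norm_sub`).
[cite: RitoreSinestrari2010, Thm. 4.2] [cite: Mantegazza2011, Thm. 2.2.1] -/
theorem IsClassicalMCF.disjoint_range
    (h₁ : IsClassicalMCF (euclideanMetric (EuclideanSpace ℝ (Fin (n + 1)))) F₁ ν₁ a b)
    (h₂ : IsClassicalMCF (euclideanMetric (EuclideanSpace ℝ (Fin (n + 1)))) F₂ ν₂ a b)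
    (hdis : Disjoint (range (F₁ a)) (range (F₂ a))) {t : ℝ} (ht : t ∈ Icc a b) :
    Disjoint (range (F₁ t)) (range (F₂ t)) := by
  haveI := h₁.compactSpace
  haveI := h₂.compactSpace
  refine Set.disjoint_left.2 fun x hx₁ hx₂ ↦ ?_
  obtain ⟨p, hp⟩ := hx₁
  obtain ⟨q, hq⟩ := hx₂
  have ha : a ∈ Icc a b := left_mem_Icc.2 (ht.1.trans ht.2)
  haveI : Nonempty (N₁ × N₂) := ⟨(p, q)⟩
  -- the initial distance is attained and positive
  have hc₁ : Continuous (F₁ a) := (h₁.isSpacelikeImmersion a ha).contMDiff_self.continuous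
  have hc₂ : Continuous (F₂ a) := (h₂.isSpacelikeImmersion a ha).contMDiff_self.continuous
  have hcont : Continuous fun k : N₁ × N₂ ↦ ‖F₁ a k.1 - F₂ a k.2‖ :=
    ((hc₁.comp continuous_fst).sub (hc₂.comp continuous_snd)).norm
  obtain ⟨k₀, -, hk₀⟩ := isCompact_univ.exists_isMinOn univ_nonempty hcont.continuousOn
  have hne : F₁ a k₀.1 ≠ F₂ a k₀.2 := fun heq ↦
    Set.disjoint_left.1 hdis (mem_range_self k₀.1) ⟨k₀.2, heq.symm⟩
  have hpos : 0 < ‖F₁ a k₀.1 - F₂ a k₀.2‖ := norm_pos_iff.2 (sub_ne_zero.2 hne)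
  have hδ' := isMinOn_univ_iff.1 hk₀
  have hδ : ∀ p' q', ‖F₁ a k₀.1 - F₂ a k₀.2‖ ≤ ‖F₁ a p' - F₂ a q'‖ := fun p' q' ↦ hδ' (p', q')
  have key := h₁.le_norm_sub h₂ hδ ht p q
  have hzero : ‖F₁ t p - F₂ t q‖ = 0 := by rw [hp, hq, sub_self, norm_zero]
  linarith

end Comparison

/-! ### Classical flows are weak set flows; they lie inside the level set flow -/

section WeakSetFlow

variable {n : ℕ} {N : Type*} [TopologicalSpace N] [ChartedSpace (EuclideanSpace ℝ (Fin n)) N]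
  [IsManifold (𝓡 n) ∞ N] {F : ℝ → N → EuclideanSpace ℝ (Fin (n + 1))}
  {ν : (t : ℝ) → NormalField (𝓡 (n + 1)) (F t)} {a b : ℝ}

/-- The spacetime track `{(F(t, y), t) : t ∈ [a, b], y ∈ N}` of a classical flow is closed
(it is compact). [folklore] -/
theorem IsClassicalMCF.isClosed_track
    (h : IsClassicalMCF (euclideanMetric (EuclideanSpace ℝ (Fin (n + 1)))) F ν a b) :
    IsClosed {p : EuclideanSpace ℝ (Fin (n + 1)) × ℝ | p.2 ∈ Icc a b ∧ p.1 ∈ range (F p.2)} := by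
  haveI := h.compactSpace
  obtain ⟨U, hU, hIU, hF⟩ := h.contMDiffOn
  have hc : ContinuousOn (fun p : ℝ × N ↦ (F p.1 p.2, p.1)) (Icc a b ×ˢ univ) :=
    (hF.continuousOn.mono (prod_mono hIU subset_rfl)).prodMk continuousOn_fst
  have hK : IsCompact ((fun p : ℝ × N ↦ (F p.1 p.2, p.1)) '' (Icc a b ×ˢ univ)) :=
    (isCompact_Icc.prod isCompact_univ).image_of_continuousOn hc
  have heq : {p : EuclideanSpace ℝ (Fin (n + 1)) × ℝ | p.2 ∈ Icc a b ∧ p.1 ∈ range (F p.2)} =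
      (fun p : ℝ × N ↦ (F p.1 p.2, p.1)) '' (Icc a b ×ˢ univ) := by
    ext ⟨x, t⟩
    simp only [mem_setOf_eq, mem_image, mem_prod, mem_univ, and_true, Prod.mk.injEq, Prod.exists,
      mem_range]
    constructor
    · rintro ⟨ht, y, rfl⟩
      exact ⟨t, y, ht, rfl, rfl⟩
    · rintro ⟨s, y, hs, rfl, rfl⟩
      exact ⟨hs, y, rfl⟩
  rw [heq]
  exact hK.isClosed

/-- **Classical mean curvature flows are weak set flows** (Hershkovits–White 2020, Def. 19 made
non-vacuous; White 2000, §2): for a classical flow `F` on `[a, b]` in `ℝⁿ⁺¹`, the family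
`t ↦ F(t, N)` (for `t ∈ [a, b]`; `∅` otherwise) is a weak set flow in `ℝⁿ⁺¹` on every time set
`I ⊆ [a, ∞)`: its track is closed (`isClosed_track`) and it avoids every classical test flow by the
avoidance principle `disjoint_range` (both flows restricted to the common interval `[a', t]`).
[cite: HershkovitsWhite2019, Appendix Def. 19] [cite: White2000, §2]
[cite: Mantegazza2011, Thm. 2.2.1] -/
theorem IsClassicalMCF.isWeakSetFlowIn
    (h : IsClassicalMCF (euclideanMetric (EuclideanSpace ℝ (Fin (n + 1)))) F ν a b) {I : Set ℝ}
    (hI : I ⊆ Ici a) :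
    IsWeakSetFlowIn (euclideanMetric (EuclideanSpace ℝ (Fin (n + 1)))) univ I
      fun t ↦ {x | t ∈ Icc a b ∧ x ∈ range (F t)} := by
  refine ⟨fun t _ ↦ subset_univ _, ⟨_, h.isClosed_track, ?_⟩, ?_⟩
  · ext ⟨x, t⟩
    simp only [mem_setOf_eq, mem_inter_iff, mem_prod, mem_univ, true_and]
    tauto
  · intro a' b' hab' hI' N' _ _ _ F' ν' hF' _ hdis t ht
    change Disjoint (range (F' t)) {x | t ∈ Icc a b ∧ x ∈ range (F t)}
    change Disjoint (range (F' a')) {x | a' ∈ Icc a b ∧ x ∈ range (F a')} at hdis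
    by_cases htab : t ∈ Icc a b
    · have haa' : a ≤ a' := hI (hI' (left_mem_Icc.2 hab'))
      have ha' : a' ∈ Icc a b := ⟨haa', ht.1.trans htab.2⟩
      have hdis' : Disjoint (range (F' a')) (range (F a')) :=
        hdis.mono_right fun x (hx : x ∈ range (F a')) ↦
          (⟨ha', hx⟩ : a' ∈ Icc a b ∧ x ∈ range (F a'))
      have h1 : IsClassicalMCF _ F' ν' a' t := hF'.mono (Icc_subset_Icc le_rfl ht.2)
      have h2 : IsClassicalMCF _ F ν a' t := h.mono (Icc_subset_Icc haa' htab.2)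
      have key := h1.disjoint_range h2 hdis' (right_mem_Icc.2 ht.1)
      exact key.mono_right fun x hx ↦ hx.2
    · have : {x : EuclideanSpace ℝ (Fin (n + 1)) | t ∈ Icc a b ∧ x ∈ range (F t)} = ∅ := by
        ext x; simp [htab]
      rw [this]
      exact disjoint_empty _

/-- **A classical mean curvature flow starting at time `0` lies inside the level set flow of
(any set containing) its initial hypersurface**: `F(t, N) ⊆ F_t(K₀)` for `t ∈ [0, b]` and
`K₀ ⊇ F(0, N)` (maximality of the level set flow, `subset_levelSetFlow`, applied to the weak set
flow `isWeakSetFlowIn`). White 2000, §2 ("the level set flow contains every weak set flow, in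
particular every smooth flow"). [cite: White2000, §2] [cite: HershkovitsWhite2019, Appendix] -/
theorem IsClassicalMCF.range_subset_levelSetFlow
    (h : IsClassicalMCF (euclideanMetric (EuclideanSpace ℝ (Fin (n + 1)))) F ν 0 b)
    {K₀ : Set (EuclideanSpace ℝ (Fin (n + 1)))} (hK₀ : range (F 0) ⊆ K₀) {t : ℝ}
    (ht : t ∈ Icc 0 b) :
    range (F t) ⊆ levelSetFlow (euclideanMetric (EuclideanSpace ℝ (Fin (n + 1)))) K₀ t := by
  have hK := h.isWeakSetFlowIn (I := Ici 0) subset_rfl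
  have h0 : {x : EuclideanSpace ℝ (Fin (n + 1)) | (0 : ℝ) ∈ Icc 0 b ∧ x ∈ range (F 0)} ⊆ K₀ :=
    fun x hx ↦ hK₀ hx.2
  have h1 : range (F t) ⊆ {x | t ∈ Icc 0 b ∧ x ∈ range (F t)} := fun x hx ↦ ⟨ht, hx⟩
  exact h1.trans (subset_levelSetFlow hK h0 ht.1)

end WeakSetFlow

/-! ### Example: the level set flow of a round sphere contains the shrinking spheres -/

section Sphere

variable {n : ℕ}

/-- **The shrinking sphere lies in the level set flow of the round sphere**: for `n ≥ 1`,
`0 ≤ t` and `2nt < r₀²`, `∂B(c, √(r₀² - 2nt)) ⊆ F_t(∂B(c, r₀))` — the classical flow of round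
spheres `isClassicalMCF_shrinkingSphereAt` (extinction time `T = r₀²/(2n)`) is inside the level
set flow (`range_subset_levelSetFlow`); with `levelSetFlow_eq_empty_of_lt`
(`LevelSetFlowExtinction.lean`: `F_t = ∅` for `2nt > r₀²`) this pins the extinction of the round
sphere at `T = r₀²/(2n)`. Huisken 1984, §1; Evans–Spruck 1991, §7.
[cite: Huisken1984, §1] [cite: White2000, §2] -/
theorem sphere_subset_levelSetFlow_sphere (hn : 1 ≤ n) (c : EuclideanSpace ℝ (Fin (n + 1)))
    {r₀ : ℝ} (hr₀ : 0 < r₀) {t : ℝ} (ht0 : 0 ≤ t) (ht : 2 * n * t < r₀ ^ 2) :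
    sphere c (Real.sqrt (r₀ ^ 2 - 2 * n * t)) ⊆
      levelSetFlow (euclideanMetric (EuclideanSpace ℝ (Fin (n + 1)))) (sphere c r₀) t := by
  have hn0 : (0 : ℝ) < n := by exact_mod_cast hn
  set T : ℝ := r₀ ^ 2 / (2 * n) with hT
  have htT : t < T := by
    rw [hT, lt_div_iff₀ (by positivity)]; linarith
  have hflow := isClassicalMCF_shrinkingSphereAt hn c T (a := 0) htT
  have hR0 : shrinkingSphereRadius n T 0 = r₀ := by
    unfold shrinkingSphereRadius
    rw [sub_zero, hT, mul_div_cancel₀ _ (by positivity), Real.sqrt_sq hr₀.le]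
  have hRt : shrinkingSphereRadius n T t = Real.sqrt (r₀ ^ 2 - 2 * n * t) := by
    unfold shrinkingSphereRadius
    congr 1
    rw [hT]; field_simp
  have h0 : range (shrinkingSphereFlowAt n c T 0) ⊆ sphere c r₀ := by
    rw [range_shrinkingSphereFlowAt hn c (lt_of_le_of_lt ht0 htT), hR0]
  have key := hflow.range_subset_levelSetFlow h0 ⟨ht0, le_rfl⟩
  rwa [range_shrinkingSphereFlowAt hn c htT, hRt] at key

/-- Hence the level set flow of a round sphere is **nonempty exactly until `T = r₀²/(2n)`**:
nonempty for `0 ≤ t`, `2nt < r₀²` (it contains a sphere of positive radius), empty for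
`2nt > r₀²` (`levelSetFlow_eq_empty_of_lt`). [cite: Huisken1984, §1] [cite: EvansSpruck1991, Thm. 7.1] -/
theorem levelSetFlow_sphere_nonempty_iff (hn : 1 ≤ n) (c : EuclideanSpace ℝ (Fin (n + 1)))
    {r₀ : ℝ} (hr₀ : 0 < r₀) {t : ℝ} (ht0 : 0 ≤ t) (ht : 2 * n * t ≠ r₀ ^ 2) :
    (levelSetFlow (euclideanMetric (EuclideanSpace ℝ (Fin (n + 1)))) (sphere c r₀) t).Nonempty ↔
      2 * n * t < r₀ ^ 2 := by
  constructor
  · intro hne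
    by_contra hle
    have hlt : r₀ ^ 2 < 2 * n * t := lt_of_le_of_ne (not_lt.1 hle) ht.symm
    -- a slightly bigger ball still goes extinct before `t`
    obtain ⟨m, hr₀m, hmt⟩ := exists_between hlt
    have hm0 : 0 ≤ m := (sq_nonneg r₀).trans hr₀m.le
    have hsub : sphere c r₀ ⊆ ball c (Real.sqrt m) := by
      intro x hx
      rw [mem_sphere] at hx
      rw [mem_ball, hx]
      calc r₀ = Real.sqrt (r₀ ^ 2) := (Real.sqrt_sq hr₀.le).symm
        _ < Real.sqrt m := Real.sqrt_lt_sqrt (sq_nonneg _) hr₀m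
    have hem := levelSetFlow_eq_empty_of_lt hn hsub (t := t) (by rwa [Real.sq_sqrt hm0])
    rw [hem] at hne
    exact Set.not_nonempty_empty hne
  · intro hlt
    have hpos : 0 < Real.sqrt (r₀ ^ 2 - 2 * n * t) := Real.sqrt_pos.2 (by linarith)
    obtain ⟨x, hx⟩ := (NormedSpace.sphere_nonempty (E := EuclideanSpace ℝ (Fin (n + 1)))
      (x := c) (r := Real.sqrt (r₀ ^ 2 - 2 * n * t))).2 hpos.le
    exact ⟨x, sphere_subset_levelSetFlow_sphere hn c hr₀ ht0 hlt hx⟩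

end Sphere

end Literature.Geometry.Riemannian

end
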